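import Summits.HodgeConjecture.HodgeCM.Model.TowerLevel_2
import Summits.HodgeConjecture.HodgeConjecture.Theorems.A3Liu413TranslateKaehlerClass
import Literature.AlgebraicGeometry.HodgeTheory.BettiUniverseHodgeRiemannFormDegreeOne
import HarnessLib

/-!
# (S) Hodge–Riemann SUMMAND CALCULUS in the currency of the tower's level carriers `towerLevel Γ`

Fan A, binder `h413` ([Liu 2021, Prop. 4.13]), junction «Matsushima at the pin», row III-4′(b), piece (S) of A-p10's class-sum (b6):
for a FAMILY of `ω`-normalised Hodge–Riemann forms `B Δ` on `H¹(X_Δ(ℂ); ℚ) ⊗ ℂ = Coh … Δ 1` over ALL levels `Δ` of `V`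
(`BettiUniverse.exists_hrFormOne` at `X_Δ := Var.scheme hU h₃ (.pms (pmsCode L ι₁ V Δ))`, `ω := ω_{X_Δ}` the class of the
named fact `BallQuotientKaehlerClassSystem`, hypothesis `hΩ`; characterisation `hB Δ` = the `hB` binder of
`BettiUniverse.hrFormOne_pull` verbatim), we prove, in the anisotropic regime (`IsAnisotropic L V.Hm`):

* (S0) `hrForm_trPull` — every rational translate pull-back `t_γ^* = trPull … γ Δ₁ Δ₂ ht 1` is an ISOMETRY `B Δ₁ (t_γ^*α) (t_γ^*β) = B Δ₂ α β`
  (`hrFormOne_pull` at `transMorU`, with `ω_{Δ₁} = t_γ^* ω_{Δ₂}` from (Ω2) `pull_transMor_omega` and the Kähler property `isKaehlerClass_omega_level`);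
* (S1) `hrForm_apply_eq_of_rel` — along the family relation `Rel Γ γ h h'` of `towerLevel Γ` the summands agree;
* (S2) `hrForm_restrictLevel_apply` — the summands are unchanged by `restrictLevel` (componentwise `t_1^*`);
* (S3) `hrForm_translate_apply` — the summands of `translate g c` at `h` are those of `c` at `h * g`;
* (S4) `hrForm_symm`, `hrForm_posDef` — Hermitian and positive definite at every level;
* (S5) `exists_hrFormFamily` — such a family exists.

No definitions; HC_CM is proved only modulo the 7 printed citations until rung 0 closes (this file consumes the named fact
`BallQuotientKaehlerClassSystem` as the hypothesis `hΩ`).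
-/

noncomputable section

open scoped Matrix TensorProduct ComplexConjugate
open Matrix Function Set
open NumberField CategoryTheory
open Literature.AlgebraicGeometry.Motives
open Literature.AlgebraicGeometry.ShimuraVarieties
open Literature.AlgebraicGeometry.HodgeTheory
open Literature.NumberTheory.Automorphic
open Literature.NumberTheory.Automorphic.PicardCM
open Literature.NumberTheory.Transcendental (Arapura2012_Cor_15_4_6)

namespace HodgeCM

namespace Model.TowerLevel

open HodgeCM.Model.LevelTranslate

variable (hHD : exists_isReal_hodgeModel) (hI : hodgePQ_independent_of_hodgeModel)
  (hU : BallQuotientUniformisedDatum) (h₃ : CMAbelianVarietyRealised) (hA : Arapura2012_Cor_15_4_6)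
variable {L : CMField} {ι₁ : L →+* ℂ} {V : HermSpace3 L ι₁}

section Summand

variable (hΩ : BallQuotientKaehlerClassSystem)
variable (B : ∀ Δ : Level V, Coh hHD hI hU h₃ Δ 1 →ₗ⋆[ℂ] Coh hHD hI hU h₃ Δ 1 →ₗ[ℂ] ℂ)
variable (hB : ∀ (Δ : Level V) (α₁ β₁ α₂ β₂ : Coh hHD hI hU h₃ Δ 1),
    α₁ ∈ (BettiUniverse.hodge hHD (Var.isSmoothProjective hU h₃ (.pms (pmsCode L ι₁ V Δ))) 1).F 1 →
    β₁ ∈ (BettiUniverse.hodge hHD (Var.isSmoothProjective hU h₃ (.pms (pmsCode L ι₁ V Δ))) 1).F 1 →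
    α₂ ∈ Literature.AlgebraicGeometry.Motives.HodgeStructure.complexConj
      ((BettiUniverse.hodge hHD (Var.isSmoothProjective hU h₃ (.pms (pmsCode L ι₁ V Δ))) 1).F 1) →
    β₂ ∈ Literature.AlgebraicGeometry.Motives.HodgeStructure.complexConj
      ((BettiUniverse.hodge hHD (Var.isSmoothProjective hU h₃ (.pms (pmsCode L ι₁ V Δ))) 1).F 1) →
    B Δ (α₁ + α₂) (β₁ + β₂) =
      Complex.I * (BettiUniverse.trC (Var.isSmoothProjective hU h₃ (.pms (pmsCode L ι₁ V Δ))) 4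
          (LinearMap.BilinMap.baseChange ℂ (BettiUniverse.cup (Var.scheme hU h₃ (.pms (pmsCode L ι₁ V Δ))) 2 2)
            (LinearMap.BilinMap.baseChange ℂ (BettiUniverse.cup (Var.scheme hU h₃ (.pms (pmsCode L ι₁ V Δ))) 1 1) β₁
              (Literature.AlgebraicGeometry.Motives.HodgeStructure.conj α₁))
            ((1 : ℂ) ⊗ₜ[ℚ] hΩ.omega (Var.scheme hU h₃ (.pms (pmsCode L ι₁ V Δ))))) /
        BettiUniverse.trC (Var.isSmoothProjective hU h₃ (.pms (pmsCode L ι₁ V Δ))) 4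
          (LinearMap.BilinMap.baseChange ℂ (BettiUniverse.cup (Var.scheme hU h₃ (.pms (pmsCode L ι₁ V Δ))) 2 2)
            ((1 : ℂ) ⊗ₜ[ℚ] hΩ.omega (Var.scheme hU h₃ (.pms (pmsCode L ι₁ V Δ))))
            ((1 : ℂ) ⊗ₜ[ℚ] hΩ.omega (Var.scheme hU h₃ (.pms (pmsCode L ι₁ V Δ)))))) -
      Complex.I * (BettiUniverse.trC (Var.isSmoothProjective hU h₃ (.pms (pmsCode L ι₁ V Δ))) 4
          (LinearMap.BilinMap.baseChange ℂ (BettiUniverse.cup (Var.scheme hU h₃ (.pms (pmsCode L ι₁ V Δ))) 2 2)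
            (LinearMap.BilinMap.baseChange ℂ (BettiUniverse.cup (Var.scheme hU h₃ (.pms (pmsCode L ι₁ V Δ))) 1 1) β₂
              (Literature.AlgebraicGeometry.Motives.HodgeStructure.conj α₂))
            ((1 : ℂ) ⊗ₜ[ℚ] hΩ.omega (Var.scheme hU h₃ (.pms (pmsCode L ι₁ V Δ))))) /
        BettiUniverse.trC (Var.isSmoothProjective hU h₃ (.pms (pmsCode L ι₁ V Δ))) 4
          (LinearMap.BilinMap.baseChange ℂ (BettiUniverse.cup (Var.scheme hU h₃ (.pms (pmsCode L ι₁ V Δ))) 2 2)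
            ((1 : ℂ) ⊗ₜ[ℚ] hΩ.omega (Var.scheme hU h₃ (.pms (pmsCode L ι₁ V Δ))))
            ((1 : ℂ) ⊗ₜ[ℚ] hΩ.omega (Var.scheme hU h₃ (.pms (pmsCode L ι₁ V Δ)))))))
include hB

/-- **(S0) The rational translates are isometries of the `ω`-normalised Hodge–Riemann forms**: for `γ ∈ U(V)(L₀)` translating `Δ₁`
into `Δ₂`, `B_{Δ₁} (t_γ^* α) (t_γ^* β) = B_{Δ₂} α β` (`BettiUniverse.hrFormOne_pull` at `t_γ = transMorU …`, since `t_γ^* ω_{Δ₂} = ω_{Δ₁}`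
— (Ω2) `pull_transMor_omega` — and `ω_{Δ₁}` is Kähler, `isKaehlerClass_omega_level`). [cite: VoisinHodgeI2002, §7.3.2 and §6.3.2 Thm. 6.32] -/
theorem hrForm_trPull (h : IsAnisotropic L V.Hm) (γ : ↥(Urat V)) {Δ₁ Δ₂ : Level V}
    (ht : TransCond (γ : GL (Fin 3) L) Δ₁ Δ₂) (α β : Coh hHD hI hU h₃ Δ₂ 1) :
    B Δ₁ (trPull hHD hI hU h₃ hA γ Δ₁ Δ₂ ht 1 α) (trPull hHD hI hU h₃ hA γ Δ₁ Δ₂ ht 1 β) = B Δ₂ α β := by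
  have e := pull_transMor_omega hU h₃ hHD hA hΩ γ.2 ht h
  have hω := isKaehlerClass_omega_level hU h₃ hΩ Δ₂ h
  have hω' : IsKaehlerClass 2 (Var.scheme hU h₃ (.pms (pmsCode L ι₁ V Δ₁)))
      (ofRatClass (ComplexPoints (Var.scheme hU h₃ (.pms (pmsCode L ι₁ V Δ₁)))) 2
        (BettiUniverse.pull (transMor hU h₃ hHD hA γ.2 Δ₁ Δ₂ ht) 2 (hΩ.omega (Var.scheme hU h₃ (.pms (pmsCode L ι₁ V Δ₂)))))) := by
    rw [e]; exact isKaehlerClass_omega_level hU h₃ hΩ Δ₁ h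
  have hB' := hB Δ₁
  rw [← e] at hB'
  exact BettiUniverse.hrFormOne_pull hHD hI (Var.isSmoothProjective hU h₃ (.pms (pmsCode L ι₁ V Δ₂)))
    (Var.isSmoothProjective hU h₃ (.pms (pmsCode L ι₁ V Δ₁))) (transMor hU h₃ hHD hA γ.2 Δ₁ Δ₂ ht)
    (hΩ.omega (Var.scheme hU h₃ (.pms (pmsCode L ι₁ V Δ₂)))) hω hω' (hB Δ₂) hB' α β

/-- **(S1) Along the family relation the summands agree**: for `c, c' ∈ towerLevel Γ` and `h' ∈ (γ)_f h K` (`Rel Γ γ h h'`),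
`B_{Γ_h} (c h) (c' h) = B_{Γ_{h'}} (c h') (c' h')` (`c h = t_γ^* (c h')`, `apply_eq_trPull`, and (S0)). [cite: VoisinHodgeI2002, §7.3.2] -/
theorem hrForm_apply_eq_of_rel (h : IsAnisotropic L V.Hm) {Γ : Level V} (hΓ : Γ.BelowConjThree)
    (c c' : towerLevel hHD hI hU h₃ hA Γ hΓ) {γ : ↥(Urat V)} {x x' : V.adelicFin} (r : Rel Γ γ x x') :
    B (Γ.conj x hΓ) ((c : Π h, W hHD hI hU h₃ Γ hΓ h) x) ((c' : Π h, W hHD hI hU h₃ Γ hΓ h) x) =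
      B (Γ.conj x' hΓ) ((c : Π h, W hHD hI hU h₃ Γ hΓ h) x') ((c' : Π h, W hHD hI hU h₃ Γ hΓ h) x') := by
  rw [apply_eq_trPull hHD hI hU h₃ hA c r (transCond_of_rel hΓ r), apply_eq_trPull hHD hI hU h₃ hA c' r (transCond_of_rel hΓ r)]
  exact hrForm_trPull hHD hI hU h₃ hA hΩ B hB h γ (transCond_of_rel hΓ r) _ _

/-- **(S2) `restrictLevel` does not change the summands**: for `Γ' ≤ Γ`, `B_{Γ'_h} ((res c) h) ((res c') h) = B_{Γ_h} (c h) (c' h)`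
(`restrictLevel_apply` = componentwise `t_1^*`, and (S0) at `γ = 1`). [cite: VoisinHodgeI2002, §7.3.2] -/
theorem hrForm_restrictLevel_apply (h : IsAnisotropic L V.Hm) {Γ Γ' : Level V} (hle : Γ' ≤ Γ) (hΓ : Γ.BelowConjThree)
    (hΓ' : Γ'.BelowConjThree) (c c' : towerLevel hHD hI hU h₃ hA Γ hΓ) (x : V.adelicFin) :
    B (Γ'.conj x hΓ') ((restrictLevel hHD hI hU h₃ hA hle hΓ hΓ' c : Π h, W hHD hI hU h₃ Γ' hΓ' h) x)
        ((restrictLevel hHD hI hU h₃ hA hle hΓ hΓ' c' : Π h, W hHD hI hU h₃ Γ' hΓ' h) x) =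
      B (Γ.conj x hΓ) ((c : Π h, W hHD hI hU h₃ Γ hΓ h) x) ((c' : Π h, W hHD hI hU h₃ Γ hΓ h) x) := by
  rw [restrictLevel_apply, restrictLevel_apply]
  exact hrForm_trPull hHD hI hU h₃ hA hΩ B hB h 1 (transCond_conj_of_le hle hΓ hΓ' x) _ _

/-- **(S3) The summands of `translate g c` at `h` are those of `c` at `h * g`**:
`B_{(Γ^g)_h} ((g • c) h) ((g • c') h) = B_{Γ_{hg}} (c (h g)) (c' (h g))` (`translate_apply` = componentwise `t_1^*`, and (S0) at `γ = 1`).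
[cite: VoisinHodgeI2002, §7.3.2] -/
theorem hrForm_translate_apply (h : IsAnisotropic L V.Hm) {Γ : Level V} (hΓ : Γ.BelowConjThree) (g : V.adelicFin)
    (c c' : towerLevel hHD hI hU h₃ hA Γ hΓ) (x : V.adelicFin) :
    B ((Γ.conj g hΓ).conj x (hΓ.conj g))
        ((translate hHD hI hU h₃ hA hΓ g c : Π h, W hHD hI hU h₃ (Γ.conj g hΓ) (hΓ.conj g) h) x)
        ((translate hHD hI hU h₃ hA hΓ g c' : Π h, W hHD hI hU h₃ (Γ.conj g hΓ) (hΓ.conj g) h) x) =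
      B (Γ.conj (x * g) hΓ) ((c : Π h, W hHD hI hU h₃ Γ hΓ h) (x * g)) ((c' : Π h, W hHD hI hU h₃ Γ hΓ h) (x * g)) := by
  rw [translate_apply, translate_apply]
  exact hrForm_trPull hHD hI hU h₃ hA hΩ B hB h 1 (transCond_conj_conj hΓ g x) _ _

/-- **(S4a) Hermitian at every level** (`BettiUniverse.hrFormOne_symm`). [cite: VoisinHodgeI2002, §6.3.2 Thm. 6.32] -/
theorem hrForm_symm (Δ : Level V) (α β : Coh hHD hI hU h₃ Δ 1) : B Δ α β = conj (B Δ β α) :=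
  BettiUniverse.hrFormOne_symm (Var.isSmoothProjective hU h₃ (.pms (pmsCode L ι₁ V Δ)))
    (hΩ.omega (Var.scheme hU h₃ (.pms (pmsCode L ι₁ V Δ)))) (hB Δ) α β

/-- **(S4b) Positive definite at every level** (`BettiUniverse.hrFormOne_posDef`, the class `ω_{X_Δ}` being Kähler,
`isKaehlerClass_omega_level`; anisotropic regime). [cite: VoisinHodgeI2002, §6.3.2 Thm. 6.32] -/
theorem hrForm_posDef (h : IsAnisotropic L V.Hm) (Δ : Level V) (α : Coh hHD hI hU h₃ Δ 1) (hα : α ≠ 0) :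
    0 < (B Δ α α).re :=
  BettiUniverse.hrFormOne_posDef (Var.isSmoothProjective hU h₃ (.pms (pmsCode L ι₁ V Δ)))
    (hΩ.omega (Var.scheme hU h₃ (.pms (pmsCode L ι₁ V Δ)))) (hB Δ) (isKaehlerClass_omega_level hU h₃ hΩ Δ h) α hα

end Summand

/-- **(S5) Existence of the family**: for every level `Δ` choose the `ω_{X_Δ}`-normalised Hodge–Riemann form of
`BettiUniverse.exists_hrFormOne`. [cite: VoisinHodgeI2002, §6.3.2 Thm. 6.32 (k = 1); §7.1.1] -/
theorem exists_hrFormFamily (hΩ : BallQuotientKaehlerClassSystem) :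
    ∃ B : ∀ Δ : Level V, Coh hHD hI hU h₃ Δ 1 →ₗ⋆[ℂ] Coh hHD hI hU h₃ Δ 1 →ₗ[ℂ] ℂ,
      ∀ (Δ : Level V) (α₁ β₁ α₂ β₂ : Coh hHD hI hU h₃ Δ 1),
        α₁ ∈ (BettiUniverse.hodge hHD (Var.isSmoothProjective hU h₃ (.pms (pmsCode L ι₁ V Δ))) 1).F 1 →
        β₁ ∈ (BettiUniverse.hodge hHD (Var.isSmoothProjective hU h₃ (.pms (pmsCode L ι₁ V Δ))) 1).F 1 →
        α₂ ∈ Literature.AlgebraicGeometry.Motives.HodgeStructure.complexConj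
          ((BettiUniverse.hodge hHD (Var.isSmoothProjective hU h₃ (.pms (pmsCode L ι₁ V Δ))) 1).F 1) →
        β₂ ∈ Literature.AlgebraicGeometry.Motives.HodgeStructure.complexConj
          ((BettiUniverse.hodge hHD (Var.isSmoothProjective hU h₃ (.pms (pmsCode L ι₁ V Δ))) 1).F 1) →
        B Δ (α₁ + α₂) (β₁ + β₂) =
          Complex.I * (BettiUniverse.trC (Var.isSmoothProjective hU h₃ (.pms (pmsCode L ι₁ V Δ))) 4
              (LinearMap.BilinMap.baseChange ℂ (BettiUniverse.cup (Var.scheme hU h₃ (.pms (pmsCode L ι₁ V Δ))) 2 2)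
                (LinearMap.BilinMap.baseChange ℂ (BettiUniverse.cup (Var.scheme hU h₃ (.pms (pmsCode L ι₁ V Δ))) 1 1) β₁
                  (Literature.AlgebraicGeometry.Motives.HodgeStructure.conj α₁))
                ((1 : ℂ) ⊗ₜ[ℚ] hΩ.omega (Var.scheme hU h₃ (.pms (pmsCode L ι₁ V Δ))))) /
            BettiUniverse.trC (Var.isSmoothProjective hU h₃ (.pms (pmsCode L ι₁ V Δ))) 4
              (LinearMap.BilinMap.baseChange ℂ (BettiUniverse.cup (Var.scheme hU h₃ (.pms (pmsCode L ι₁ V Δ))) 2 2)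
                ((1 : ℂ) ⊗ₜ[ℚ] hΩ.omega (Var.scheme hU h₃ (.pms (pmsCode L ι₁ V Δ))))
                ((1 : ℂ) ⊗ₜ[ℚ] hΩ.omega (Var.scheme hU h₃ (.pms (pmsCode L ι₁ V Δ)))))) -
          Complex.I * (BettiUniverse.trC (Var.isSmoothProjective hU h₃ (.pms (pmsCode L ι₁ V Δ))) 4
              (LinearMap.BilinMap.baseChange ℂ (BettiUniverse.cup (Var.scheme hU h₃ (.pms (pmsCode L ι₁ V Δ))) 2 2)
                (LinearMap.BilinMap.baseChange ℂ (BettiUniverse.cup (Var.scheme hU h₃ (.pms (pmsCode L ι₁ V Δ))) 1 1) β₂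
                  (Literature.AlgebraicGeometry.Motives.HodgeStructure.conj α₂))
                ((1 : ℂ) ⊗ₜ[ℚ] hΩ.omega (Var.scheme hU h₃ (.pms (pmsCode L ι₁ V Δ))))) /
            BettiUniverse.trC (Var.isSmoothProjective hU h₃ (.pms (pmsCode L ι₁ V Δ))) 4
              (LinearMap.BilinMap.baseChange ℂ (BettiUniverse.cup (Var.scheme hU h₃ (.pms (pmsCode L ι₁ V Δ))) 2 2)
                ((1 : ℂ) ⊗ₜ[ℚ] hΩ.omega (Var.scheme hU h₃ (.pms (pmsCode L ι₁ V Δ))))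
                ((1 : ℂ) ⊗ₜ[ℚ] hΩ.omega (Var.scheme hU h₃ (.pms (pmsCode L ι₁ V Δ)))))) :=
  ⟨fun Δ => (BettiUniverse.exists_hrFormOne hHD (Var.isSmoothProjective hU h₃ (.pms (pmsCode L ι₁ V Δ)))
      (hΩ.omega (Var.scheme hU h₃ (.pms (pmsCode L ι₁ V Δ))))).choose,
    fun Δ => (BettiUniverse.exists_hrFormOne hHD (Var.isSmoothProjective hU h₃ (.pms (pmsCode L ι₁ V Δ)))
      (hΩ.omega (Var.scheme hU h₃ (.pms (pmsCode L ι₁ V Δ))))).choose_spec⟩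

end Model.TowerLevel

end HodgeCM

end
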